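import Summits.QuantumFields.BalabanUV.Beta.SecondOrderSeparationCalculus
import Summits.QuantumFields.BalabanUV.Beta.SecondOrderStepRemainderWall
import Summits.QuantumFields.BalabanUV.Beta.BorderedHessianStepParity
import Summits.QuantumFields.BalabanUV.Beta.WardLocusCubic
import Summits.QuantumFields.BalabanUV.Beta.SpineRecursiveWEnd

/-!
# `BalabanUV.Beta.SecondOrderClassStep` — binder row D1, the W-side (L4) of hR, leaf (W-CLASS-Q), part 4: THE CLASS STEP OF THE REMAINDER
# RECURSION — from separation-localised data `(X2s, Δ)` and parity-odd `Δ` at level `j`, the symmetrised residual `V` meets the three inputs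
# `hVl`∕`hVt`∕`hhl` of `SecondOrderStepRemainderWall.…_of_residual`, and the next remainder `R2 (j+1)` (the owner's `hR2succ` shape,
# `SpineRecursiveT2All` p216525) is again `LocStencil₂` with parity-odd rows
# (β sub-cell, D1 formalisation swarm seat `b2b-balaban-beta-d1-formalise-leaf-05`, gen 5; row HR-W-CLASS-Q, typer-g4 l.11945)

HONEST FRAMING (cell contract, verbatim): «discharging `BetaPertH` makes Bałaban's UV stability UNCONDITIONAL — a real
constructive-QFT result; it is NOT the continuum limit and NOT the Clay problem.»  HONEST DEPENDENCY (verbatim): «continuum YM on T⁴ ⇐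
BetaPertH ∧ nine spine estimates (0/9 proved); BetaPertH ⇐ (D1) ∧ (D4) ∧ CAP+tail; G-an2-4 gates asym, D1 and NE2/3/4.»  [folklore]
analysis∕parity bookkeeping; no statement of Bałaban's papers, no `[cite:]` tag, no `def`, no `Prop` fact; instantiates NO binder of the
β-function wall; NOT D1, NOT `BetaPertH`, NOT continuum, NOT Clay.  ABSOLUTE RULE (cell, verbatim): «No internally-minted statement may enter
as a cited fact. Every hypothesis is either kernel-proved in this package or a verbatim quotation of a PUBLISHED theorem with page reference. The
manuscript(s) under audit are NOT citable for their own disputed steps — they are the thing under adjudication; programme-internal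
(2001/route/tribunal) claims are never citable.»  Nothing is cited here.

## What is proved (generic `d`, in-block root `toSite r`, `Lc ≥ 1`; `G_j := coDressKBmAt (toSite r) Lc (KInvStep Lc j)`, `𝕄_j := bhKStepAt d (toSite r) Lc j`)

For ARBITRARY bond-pair families `X2s` (symbols) and `Δ` (kernels) — the free binders of the owner's END — and the END's symmetrised residual
`V κ u κ′ u′ := ½•conjV 𝕄_j (diagK (X2s κ′u′κu − X2s κuκ′u′)) + ½•(Δ κuκ′u′ + Δ κ′u′κu)`:
* §1 **`biLoc_symV_of_sep`** (= the Wall's `hVl`): if `κuκ′u′ ↦ diagK (X2s κuκ′u′)` and `Δ` are separation-localised (part 3's shape) then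
  `∃ Cv δv, 0 < δv ∧ ∀ κ u κ′ u′, BiLoc (V κ u κ′ u′) (Lc•u) (Lc•u) (Cv·e^{−δv·l1 (u′ − u)}) δv`; **`parityOdd_symV`** (= `hVt`) from parity-odd
  `Δ` alone (`BorderedHessianStepParity.parityOdd_symRem`); **`locStencil₂_diagK_mmSym_of_sep`** (= `hhl` for the symbol `mmSym Lc ∘ X2s` of
  `hR2succ`'s third summand): a separation-localised diagonal family read on the step lattice through `WardLocusCubic.mmSym` is `LocStencil₂`.
* §2 **`locStencil₂_R2succ`** ∕ **`parityOdd_R2succ`**: the next remainder in the owner's displayed recursion,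
  `R′ κuκ′u′ := −(a • mmRead Lc (G_j ∘ V κuκ′u′ ∘ G_j)) + RB κuκ′u′ + conjV (mmRead Lc G_j) (diagK fun p c => a·mmSym Lc (X2s κuκ′u′) p c − w·h′ κuκ′u′ p c)`,
  is `LocStencil₂` at some rate and row-parity-odd — from the §1 data, the border remainder's class∕parity and the next symbol's class
  (`SecondOrderStepRemainder(Wall)` by name).  The literal instantiation (displayed `X2s`, `Δ` of `SecondOrderSplitLiteral`) is part 5.
Provenance: b2b-balaban β sub-cell, D1 formalisation swarm leaf-05 gen 5, 2026-08-20 (v1); no existing file touched.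
-/

noncomputable section

open Finset
open scoped BigOperators
open Literature.MathematicalPhysics.QuantumFieldTheory
open Literature.MathematicalPhysics.QuantumFieldTheory.Balaban1983to89
open Literature.MathematicalPhysics.QuantumFieldTheory.Balaban1983to89.Beta
open B12Sec2to5 (l1 l1_nonneg)
open ExpKernelCalculus (MKer Site Decays BiLoc comp Zl Zl_nonneg l1_sub_symm)
open AffineAveraging (box toSite)
open OneStepResolventKernel (Fib decays_mono biLoc_mono)
open OneStepKernelFamily (KInvStep)
open BalabanStepJetsSucc (mmRead l1_sub_le_l1_smul_sub)
open BalabanCompositeJets (LocStencil₂)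
open BalabanStepW2 (biLoc_le_mono)
open Summit.QuantumFields.BalabanUV.Beta.TameKernelCalculus
open Summit.QuantumFields.BalabanUV.Beta.ChartConjugation (conjV)
open Summit.QuantumFields.BalabanUV.Beta.BorderedHessian (sgnK diagK diagK_apply bhKStepAt spr_bhKStepAt)
open Summit.QuantumFields.BalabanUV.Beta.BubbleParity (spr_of_decays trK_coDressKBmAt_KInvStep)
open Summit.QuantumFields.BalabanUV.Beta.AxialDressingRooted (coDressKBmAt decays_coDressKBmAt_KInvStep)
open Summit.QuantumFields.BalabanUV.Beta.WardLocusCubic (mmSym)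
open Summit.QuantumFields.BalabanUV.Beta.SpineRooted (diagK_sub)
open Summit.QuantumFields.BalabanUV.Beta.SpineRecursiveParity (parityOdd_sandwich)
open Summit.QuantumFields.BalabanUV.Beta.SecondOrderStepRemainder (locStencil₂_mmRead_sandwich)
open Summit.QuantumFields.BalabanUV.Beta.SecondOrderStepRemainderWall (locStencil₂_stepRemainder_stepProp parityOdd_stepRemainder_stepProp)
open Summit.QuantumFields.BalabanUV.Beta.BorderedHessianStepParity (parityOdd_symRem)
open Summit.QuantumFields.BalabanUV.Beta.SecondOrderSeparationCalculus (sep_symRem)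

namespace Summit.QuantumFields.BalabanUV.Beta.SecondOrderClassStep

variable {d : ℕ} {Lc : ℕ} [NeZero Lc]

/-! ## §1 The symmetrised residual meets the Wall's `hVl` ∕ `hVt` ∕ `hhl` -/

section SymV

omit [NeZero Lc] in
/-- [folklore] **`hVl` FROM SEPARATION-LOCALISED DATA**: for any bond-pair symbol family `X2s` whose diagonal kernels are separation-localised and any
separation-localised kernel family `Δ`, the symmetrised residual `V` against a decaying `𝕄` is bi-localised at the dilated first bond with a
constant decaying in the UNDILATED separation `|u′ − u|` — EXACTLY the `hVl` binder of `SecondOrderStepRemainderWall.…_of_residual`. -/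
theorem biLoc_symV_of_sep (hLc : 1 ≤ Lc) {𝕄 : MKer (d + 1) (Fib d)} (h𝕄 : ∃ δ C : ℝ, 0 < δ ∧ 0 ≤ C ∧ Decays 𝕄 C δ)
    {X2s : Fin (d + 1) → (Fin (d + 1) → ℤ) → Fin (d + 1) → (Fin (d + 1) → ℤ) → (Fin (d + 1) → ℤ) → Fib d → ℝ}
    (hX : ∃ C δ : ℝ, 0 < δ ∧ ∀ μ y ν y', BiLoc (diagK (X2s μ y ν y')) ((Lc : ℤ) • y) ((Lc : ℤ) • y) (C * Real.exp (-δ * l1 ((Lc : ℤ) • y - (Lc : ℤ) • y'))) δ)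
    {Δ : Fin (d + 1) → (Fin (d + 1) → ℤ) → Fin (d + 1) → (Fin (d + 1) → ℤ) → MKer (d + 1) (Fib d)}
    (hΔ : ∃ C δ : ℝ, 0 < δ ∧ ∀ μ y ν y', BiLoc (Δ μ y ν y') ((Lc : ℤ) • y) ((Lc : ℤ) • y) (C * Real.exp (-δ * l1 ((Lc : ℤ) • y - (Lc : ℤ) • y'))) δ) :
    ∃ Cv δv : ℝ, 0 < δv ∧ ∀ κ u κ' u',
      BiLoc ((1 / 2 : ℝ) • conjV 𝕄 (diagK fun p a => X2s κ' u' κ u p a - X2s κ u κ' u' p a) + (1 / 2 : ℝ) • (Δ κ u κ' u' + Δ κ' u' κ u))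
        ((Lc : ℤ) • u) ((Lc : ℤ) • u) (Cv * Real.exp (-δv * l1 (u' - u))) δv := by
  obtain ⟨C, δ, hδ, h⟩ := sep_symRem (N := Lc) (P := Δ) (Q := fun μ y ν y' => diagK (X2s μ y ν y')) h𝕄 hΔ hX
  have hC : 0 ≤ C := by
    have := (h 0 0 0 0).nonneg (Sum.inl 0); simp [l1] at this; exact this
  refine ⟨C, δ, hδ, fun κ u κ' u' => ?_⟩
  have h1 := h κ u κ' u'
  rw [← diagK_sub] at h1
  refine biLoc_le_mono h1 (by positivity) (mul_le_mul_of_nonneg_left (Real.exp_le_exp.2 ?_) hC) le_rfl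
  have e : l1 (u' - u) ≤ l1 ((Lc : ℤ) • u - (Lc : ℤ) • u') := by
    rw [l1_sub_symm u' u]; exact l1_sub_le_l1_smul_sub hLc u u'
  nlinarith [hδ.le, e]

/-- [folklore] **`hVt` FROM PARITY-ODD `Δ` ALONE**: the symmetrised residual against `𝕄_j := bhKStepAt d ρ Lc j` is row-parity-odd for ANY symbol
family (`BorderedHessianStepParity.parityOdd_symRem`). -/
theorem parityOdd_symV (ρ : Fin (d + 1) → ℤ) (j : ℕ)
    (X2s : Fin (d + 1) → (Fin (d + 1) → ℤ) → Fin (d + 1) → (Fin (d + 1) → ℤ) → (Fin (d + 1) → ℤ) → Fib d → ℝ)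
    {Δ : Fin (d + 1) → (Fin (d + 1) → ℤ) → Fin (d + 1) → (Fin (d + 1) → ℤ) → MKer (d + 1) (Fib d)}
    (hΔt : ∀ μ y ν y', trK (Δ μ y ν y') = -sgnK (Δ μ y ν y')) (κ : Fin (d + 1)) (u : Fin (d + 1) → ℤ) (κ' : Fin (d + 1))
    (u' : Fin (d + 1) → ℤ) :
    trK ((1 / 2 : ℝ) • conjV (bhKStepAt d ρ Lc j) (diagK fun p a => X2s κ' u' κ u p a - X2s κ u κ' u' p a) +
        (1 / 2 : ℝ) • (Δ κ u κ' u' + Δ κ' u' κ u)) =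
      -sgnK ((1 / 2 : ℝ) • conjV (bhKStepAt d ρ Lc j) (diagK fun p a => X2s κ' u' κ u p a - X2s κ u κ' u' p a) +
        (1 / 2 : ℝ) • (Δ κ u κ' u' + Δ κ' u' κ u)) :=
  parityOdd_symRem ρ Lc j _ (hΔt κ u κ' u') (hΔt κ' u' κ u)

omit [NeZero Lc] in
/-- [folklore] **`hhl` FOR THE STEP-LATTICE SYMBOL `mmSym Lc ∘ X2s`**: a bond-pair symbol family whose diagonal kernels are separation-localised
(dilated first bond, fine lattice) reads through `WardLocusCubic.mmSym Lc` as a `LocStencil₂` family on the step lattice (centre the undilated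
bond `u`, constant decaying in `|u′ − u|`; `l1 (x′ − u) ≤ l1 (Lc•x′ − Lc•u)`). -/
theorem locStencil₂_diagK_mmSym_of_sep (hLc : 1 ≤ Lc)
    {X2s : Fin (d + 1) → (Fin (d + 1) → ℤ) → Fin (d + 1) → (Fin (d + 1) → ℤ) → (Fin (d + 1) → ℤ) → Fib d → ℝ}
    (hX : ∃ C δ : ℝ, 0 < δ ∧ ∀ μ y ν y', BiLoc (diagK (X2s μ y ν y')) ((Lc : ℤ) • y) ((Lc : ℤ) • y) (C * Real.exp (-δ * l1 ((Lc : ℤ) • y - (Lc : ℤ) • y'))) δ) :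
    ∃ Ch δh : ℝ, 0 < δh ∧ LocStencil₂ (fun κ u κ' u' => diagK (mmSym Lc (X2s κ u κ' u'))) Ch δh := by
  classical
  obtain ⟨C, δ, hδ, h⟩ := hX
  have hC : 0 ≤ C := by
    have := (h 0 0 0 0).nonneg (Sum.inl 0); simp [l1] at this; exact this
  refine ⟨C, δ, hδ, fun κ u κ' u' x' z' a b => ?_⟩
  have hsep : Real.exp (-δ * l1 ((Lc : ℤ) • u - (Lc : ℤ) • u')) ≤ Real.exp (-δ * l1 (u' - u)) := by
    refine Real.exp_le_exp.2 ?_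
    have e : l1 (u' - u) ≤ l1 ((Lc : ℤ) • u - (Lc : ℤ) • u') := by
      rw [l1_sub_symm u' u]; exact l1_sub_le_l1_smul_sub hLc u u'
    nlinarith [hδ.le]
  show |diagK (mmSym Lc (X2s κ u κ' u')) x' z' a b| ≤ C * Real.exp (-δ * l1 (u' - u)) * Real.exp (-δ * (l1 (x' - u) + l1 (z' - u)))
  rw [diagK_apply]
  split_ifs with hxz
  · obtain ⟨rfl, rfl⟩ := hxz
    rcases a with α | m
    · -- field leg of the step lattice = multiplier leg of the dilated point
      have h1 := h κ u κ' u' ((Lc : ℤ) • x') ((Lc : ℤ) • x') (Sum.inr α) (Sum.inr α)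
      rw [diagK_apply, if_pos ⟨rfl, rfl⟩] at h1
      have ex : l1 (x' - u) ≤ l1 ((Lc : ℤ) • x' - (Lc : ℤ) • u) := l1_sub_le_l1_smul_sub hLc x' u
      calc |mmSym Lc (X2s κ u κ' u') x' (Sum.inl α)| = |X2s κ u κ' u' ((Lc : ℤ) • x') (Sum.inr α)| := rfl
        _ ≤ C * Real.exp (-δ * l1 ((Lc : ℤ) • u - (Lc : ℤ) • u')) *
              Real.exp (-δ * (l1 ((Lc : ℤ) • x' - (Lc : ℤ) • u) + l1 ((Lc : ℤ) • x' - (Lc : ℤ) • u))) := h1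
        _ ≤ C * Real.exp (-δ * l1 (u' - u)) * Real.exp (-δ * (l1 (x' - u) + l1 (x' - u))) := by
              refine mul_le_mul (mul_le_mul_of_nonneg_left hsep hC) (Real.exp_le_exp.2 (by nlinarith [hδ.le])) (Real.exp_pos _).le
                (by positivity)
    · show |(0 : ℝ)| ≤ _
      rw [abs_zero]; positivity
  · rw [abs_zero]; positivity

end SymV

/-! ## §2 The next remainder of the owner's recursion is `LocStencil₂` with parity-odd rows -/

section Succ

/-- [folklore] The transported residual `mmRead Lc (G_j ∘ V ∘ G_j)` is a `LocStencil₂` family (some rate) once `V` is bi-localised at the dilated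
first bond with a separation-decaying constant at SOME rate (`SecondOrderStepRemainder.locStencil₂_mmRead_sandwich` at a common rate with `G_j`). -/
theorem locStencil₂_mmRead_sandwich_stepProp (hLc : 1 ≤ Lc) {r : Fin (d + 1) → ℕ} (hr : r ∈ box (d + 1) Lc) (j : ℕ)
    {V : Fin (d + 1) → (Fin (d + 1) → ℤ) → Fin (d + 1) → (Fin (d + 1) → ℤ) → MKer (d + 1) (Fib d)}
    (hVl : ∃ Cv δv : ℝ, 0 < δv ∧ ∀ κ u κ' u', BiLoc (V κ u κ' u') ((Lc : ℤ) • u) ((Lc : ℤ) • u) (Cv * Real.exp (-δv * l1 (u' - u))) δv) :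
    ∃ C₀ δ₀ : ℝ, 0 < δ₀ ∧ LocStencil₂ (fun κ u κ' u' => mmRead Lc
      (comp (comp (coDressKBmAt (toSite r) Lc (KInvStep (d := d) Lc j)) (V κ u κ' u')) (coDressKBmAt (toSite r) Lc (KInvStep (d := d) Lc j))))
      C₀ δ₀ := by
  obtain ⟨δG, CG, hδG, hCG, hG⟩ := decays_coDressKBmAt_KInvStep (d := d) hr j
  obtain ⟨Cv, δv, hδv, hV⟩ := hVl
  set m : ℝ := min δG δv with hm_def
  have hm : 0 < m := lt_min hδG hδv
  have hGm : Decays (coDressKBmAt (toSite r) Lc (KInvStep (d := d) Lc j)) CG m := decays_mono hG hCG le_rfl (min_le_left _ _)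
  have hVm : ∀ κ u κ' u', BiLoc (V κ u κ' u') ((Lc : ℤ) • u) ((Lc : ℤ) • u) (Cv * Real.exp (-m * l1 (u' - u))) m := by
    intro κ u κ' u'
    have hCvu : 0 ≤ Cv * Real.exp (-δv * l1 (u' - u)) := (hV κ u κ' u').nonneg (Sum.inl 0)
    have hCv : 0 ≤ Cv := (mul_nonneg_iff_of_pos_right (Real.exp_pos _)).mp hCvu
    refine biLoc_le_mono (hV κ u κ' u') hCvu (mul_le_mul_of_nonneg_left (Real.exp_le_exp.2 ?_) hCv) (min_le_right _ _)
    nlinarith [l1_nonneg (u' - u), min_le_right δG δv]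
  exact ⟨_, m / 4, by positivity, locStencil₂_mmRead_sandwich hLc hGm hm hVm⟩

variable {X2s : Fin (d + 1) → (Fin (d + 1) → ℤ) → Fin (d + 1) → (Fin (d + 1) → ℤ) → (Fin (d + 1) → ℤ) → Fib d → ℝ}
  {Δ RB : Fin (d + 1) → (Fin (d + 1) → ℤ) → Fin (d + 1) → (Fin (d + 1) → ℤ) → MKer (d + 1) (Fib d)}
  {h' : Fin (d + 1) → (Fin (d + 1) → ℤ) → Fin (d + 1) → (Fin (d + 1) → ℤ) → (Fin (d + 1) → ℤ) → Fib d → ℝ}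

/-- [folklore] **THE NEXT REMAINDER IS A `LocStencil₂` FAMILY**: for the owner's displayed recursion
`R′ κuκ′u′ := −(a • mmRead Lc (G_j ∘ V κuκ′u′ ∘ G_j)) + RB κuκ′u′ + conjV (mmRead Lc G_j) (diagK fun p c => a·mmSym Lc (X2s κuκ′u′) p c − w·h′ κuκ′u′ p c)`
with the symmetrised residual `V` of §1: separation-localised `diagK ∘ X2s` and `Δ`, `LocStencil₂` classes of `RB` and of `diagK ∘ h′` at SOME rates
⇒ `∃ C δ, 0 < δ ∧ LocStencil₂ R′ C δ`. -/
theorem locStencil₂_R2succ (hLc : 1 ≤ Lc) {r : Fin (d + 1) → ℕ} (hr : r ∈ box (d + 1) Lc) (j : ℕ) (a w : ℝ)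
    (hX : ∃ C δ : ℝ, 0 < δ ∧ ∀ μ y ν y', BiLoc (diagK (X2s μ y ν y')) ((Lc : ℤ) • y) ((Lc : ℤ) • y) (C * Real.exp (-δ * l1 ((Lc : ℤ) • y - (Lc : ℤ) • y'))) δ)
    (hΔ : ∃ C δ : ℝ, 0 < δ ∧ ∀ μ y ν y', BiLoc (Δ μ y ν y') ((Lc : ℤ) • y) ((Lc : ℤ) • y) (C * Real.exp (-δ * l1 ((Lc : ℤ) • y - (Lc : ℤ) • y'))) δ)
    (hBl : ∃ CB δB : ℝ, 0 < δB ∧ LocStencil₂ RB CB δB)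
    (hbl : ∃ Cb δb : ℝ, 0 < δb ∧ LocStencil₂ (fun κ u κ' u' => diagK (h' κ u κ' u')) Cb δb) :
    ∃ C δ : ℝ, 0 < δ ∧ LocStencil₂ (fun κ u κ' u' =>
      -(a • mmRead Lc (comp (comp (coDressKBmAt (toSite r) Lc (KInvStep (d := d) Lc j))
          ((1 / 2 : ℝ) • conjV (bhKStepAt d (toSite r) Lc j) (diagK fun p a => X2s κ' u' κ u p a - X2s κ u κ' u' p a) +
            (1 / 2 : ℝ) • (Δ κ u κ' u' + Δ κ' u' κ u)))
          (coDressKBmAt (toSite r) Lc (KInvStep (d := d) Lc j)))) + RB κ u κ' u' +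
        conjV (mmRead Lc (coDressKBmAt (toSite r) Lc (KInvStep (d := d) Lc j)))
          (diagK fun p c => a * mmSym Lc (X2s κ u κ' u') p c - w * h' κ u κ' u' p c)) C δ :=
  locStencil₂_stepRemainder_stepProp hLc hr j
    (locStencil₂_mmRead_sandwich_stepProp hLc hr j (biLoc_symV_of_sep hLc (spr_bhKStepAt_pkg hr j) hX hΔ)) hBl a w
    (hh := fun κ u κ' u' => mmSym Lc (X2s κ u κ' u')) (hB' := h') (locStencil₂_diagK_mmSym_of_sep hLc hX) hbl
where
  /-- the decay package of `𝕄_j` in the shape the calculus wants -/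
  spr_bhKStepAt_pkg {r : Fin (d + 1) → ℕ} (hr : r ∈ box (d + 1) Lc) (j : ℕ) :
      ∃ δ C : ℝ, 0 < δ ∧ 0 ≤ C ∧ Decays (bhKStepAt d (toSite r) Lc j) C δ := by
    obtain ⟨C, δ, hδ, h⟩ := spr_bhKStepAt (d := d) hr j
    exact ⟨δ, |C|, hδ, abs_nonneg C, fun x z a b => (h x z a b).trans (mul_le_mul_of_nonneg_right (le_abs_self C) (Real.exp_pos _).le)⟩

/-- [folklore] **THE NEXT REMAINDER HAS PARITY-ODD ROWS**: for the same displayed recursion, parity-odd `Δ` and parity-odd rows of `RB` suffice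
(the sandwich of the parity-odd localised `V` is parity-odd: `parityOdd_sandwich`; the commutator term by `parityOdd_conjV_diagK_of_even`). -/
theorem parityOdd_R2succ (hLc : 1 ≤ Lc) {r : Fin (d + 1) → ℕ} (hr : r ∈ box (d + 1) Lc) (j : ℕ) (a w : ℝ)
    (hX : ∃ C δ : ℝ, 0 < δ ∧ ∀ μ y ν y', BiLoc (diagK (X2s μ y ν y')) ((Lc : ℤ) • y) ((Lc : ℤ) • y) (C * Real.exp (-δ * l1 ((Lc : ℤ) • y - (Lc : ℤ) • y'))) δ)
    (hΔ : ∃ C δ : ℝ, 0 < δ ∧ ∀ μ y ν y', BiLoc (Δ μ y ν y') ((Lc : ℤ) • y) ((Lc : ℤ) • y) (C * Real.exp (-δ * l1 ((Lc : ℤ) • y - (Lc : ℤ) • y'))) δ)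
    (hΔt : ∀ μ y ν y', trK (Δ μ y ν y') = -sgnK (Δ μ y ν y')) (hBt : ∀ κ u κ' u', trK (RB κ u κ' u') = -sgnK (RB κ u κ' u'))
    (κ : Fin (d + 1)) (u : Fin (d + 1) → ℤ) (κ' : Fin (d + 1)) (u' : Fin (d + 1) → ℤ) :
    trK (-(a • mmRead Lc (comp (comp (coDressKBmAt (toSite r) Lc (KInvStep (d := d) Lc j))
          ((1 / 2 : ℝ) • conjV (bhKStepAt d (toSite r) Lc j) (diagK fun p a => X2s κ' u' κ u p a - X2s κ u κ' u' p a) +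
            (1 / 2 : ℝ) • (Δ κ u κ' u' + Δ κ' u' κ u)))
          (coDressKBmAt (toSite r) Lc (KInvStep (d := d) Lc j)))) + RB κ u κ' u' +
        conjV (mmRead Lc (coDressKBmAt (toSite r) Lc (KInvStep (d := d) Lc j)))
          (diagK fun p c => a * mmSym Lc (X2s κ u κ' u') p c - w * h' κ u κ' u' p c)) =
      -sgnK (-(a • mmRead Lc (comp (comp (coDressKBmAt (toSite r) Lc (KInvStep (d := d) Lc j))
          ((1 / 2 : ℝ) • conjV (bhKStepAt d (toSite r) Lc j) (diagK fun p a => X2s κ' u' κ u p a - X2s κ u κ' u' p a) +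
            (1 / 2 : ℝ) • (Δ κ u κ' u' + Δ κ' u' κ u)))
          (coDressKBmAt (toSite r) Lc (KInvStep (d := d) Lc j)))) + RB κ u κ' u' +
        conjV (mmRead Lc (coDressKBmAt (toSite r) Lc (KInvStep (d := d) Lc j)))
          (diagK fun p c => a * mmSym Lc (X2s κ u κ' u') p c - w * h' κ u κ' u' p c)) := by
  obtain ⟨Cv, δv, hδv, hV⟩ := biLoc_symV_of_sep hLc (locStencil₂_R2succ.spr_bhKStepAt_pkg (d := d) hr j) hX hΔ
  have h₀ : ∀ κ u κ' u', trK (comp (comp (coDressKBmAt (toSite r) Lc (KInvStep (d := d) Lc j))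
      ((1 / 2 : ℝ) • conjV (bhKStepAt d (toSite r) Lc j) (diagK fun p a => X2s κ' u' κ u p a - X2s κ u κ' u' p a) +
        (1 / 2 : ℝ) • (Δ κ u κ' u' + Δ κ' u' κ u))) (coDressKBmAt (toSite r) Lc (KInvStep (d := d) Lc j))) =
      -sgnK (comp (comp (coDressKBmAt (toSite r) Lc (KInvStep (d := d) Lc j))
      ((1 / 2 : ℝ) • conjV (bhKStepAt d (toSite r) Lc j) (diagK fun p a => X2s κ' u' κ u p a - X2s κ u κ' u' p a) +
        (1 / 2 : ℝ) • (Δ κ u κ' u' + Δ κ' u' κ u))) (coDressKBmAt (toSite r) Lc (KInvStep (d := d) Lc j))) :=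
    fun κ u κ' u' => parityOdd_sandwich (spr_of_decays (decays_coDressKBmAt_KInvStep hr j)) ⟨_, _, _, δv, hδv, hV κ u κ' u'⟩
      (trK_coDressKBmAt_KInvStep hr j) (parityOdd_symV (toSite r) j X2s hΔt κ u κ' u')
  exact parityOdd_stepRemainder_stepProp hr j
    (R₀ := fun κ u κ' u' => comp (comp (coDressKBmAt (toSite r) Lc (KInvStep (d := d) Lc j))
      ((1 / 2 : ℝ) • conjV (bhKStepAt d (toSite r) Lc j) (diagK fun p a => X2s κ' u' κ u p a - X2s κ u κ' u' p a) +
        (1 / 2 : ℝ) • (Δ κ u κ' u' + Δ κ' u' κ u))) (coDressKBmAt (toSite r) Lc (KInvStep (d := d) Lc j)))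
    h₀ hBt a w (fun κ u κ' u' => mmSym Lc (X2s κ u κ' u')) h' κ u κ' u'

end Succ

end Summit.QuantumFields.BalabanUV.Beta.SecondOrderClassStep

end
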